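import Summits.QuantumFields.YangMills.Theorems.AllWindowsColdBoxBoxHighLineCubicCutSetRecord

/-!
# The CUT small field of record — the `t = 1` CURRENCY SWITCH in β-letters (ASSEMBLY-U5 v0.4 §3, Step C′; planner ym-idea-2 g18 GO 2026-08-30T00:44:41Z)
# (LINE-20 U5 ⟨stmt-QuantumFields-24336⟩; U5 prep, helper-grade glue; U5 OPEN)

Width seat `ym-line-sfw-p2-w4` (prover-ym-line-sfw-p2-w4-g29-0).  Composition of ✓`GaussNormalForm.abs_chartCov_sub_tiltCov_muCut_one_le_chartPlaqCost`
(w2 g33: the FP-chart covariance over the small field `D = smallField H s` differs from the `t = 1` tilted covariance over the CUT Gaussian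
`μ_{D′}`, `D′ = D ∖ E`, by at most `96·τ`, given the cut `∫_{D ∩ E} w_J ≤ τ·∫_{D ∖ E} w_J`, `τ ≤ 1/2`, and FP invertibility on `D`) with the
cut-set record ✓`CutSetRecord.exists_cutSet_record` (w4 g29) at `τ = β^{−q}`:

* `exists_beta0_sideConditions` — for `β ≥ β₀`, `1 ≤ H ≤ β^θ + 1`, `s = β^{−1/2+κ₃}`: `s ≤ 1`, `s < π`, `252·s < 1/4/H²`
  (⟸ `2θ < 1/2 − κ₃` ⟸ (K4)), FP invertibility `∀ a ∈ smallField H s, det M_FP(edgeChart a) ≠ 0` (✓`GaussNormalForm.det_fpOperator_edgeChart_ne_zero`),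
  and `β^{−q} ≤ 1/2` (`q > 0`) — NO hypothesis beyond (K4) and `q > 0`;
* ★★ **`exists_cutSet_record_switch`** — ✓`exists_cutSet_record` (i)–(iv) with the SAME `C₅`, plus (v) the side conditions and (vi) the switch
  `∀ r ≥ s, ∀ x y, |Cov^{w_J}_{D}(c_x, c_y) − Tilt.tiltCov μ_{D′} (tiltU β H) 1 c_x c_y| ≤ 96·β^{−q}` (`c_x = chartPlaqCost H x 1 2`);
* ★ **`exists_cutSet_record_eps`** — the ε-form at `q := 8θ + 3` (✓`AssemblyBudget.cut_budget`, w2 g33): for every `ε > 0` ONE `C₅`, ONE `β₀` with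
  (i)–(vi) and `β²·H⁸·|Cov^{w_J}_{D}(c_x, c_y) − Tilt.tiltCov μ_{D′} (tiltU β H) 1 c_x c_y| ≤ ε`.

Everything proved; no definitions; standard axioms.  HONEST LABEL: U5 prep, helper-grade glue; U5 ⟨24336⟩, ⟨24004⟩ and the seat's own crux
⟨22884⟩ remain OPEN; no stub is closed by name, no crux, rung or summit is proved; **the Yang–Mills mass gap is NOT proved by this file; no summit
is proved by a line.**
-/

set_option autoImplicit false

open MeasureTheory Real Finset
open Literature.Probability.LatticeModels (Site)

namespace Summit.QuantumFields.YangMills.Theorems.AllWindowsColdBoxBoxHighLine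

namespace CutSetRecord

open SmallFieldFP SmallFieldFPSharp TiltSup EdgeChartGaussian GaussRestrict

variable {H : ℕ}

/-- ★ **Side conditions at `s = β^{−1/2+κ₃}`, eventually in β**: for `0 < θ`, `0 < κ₃`, (K4) `κ₃ + 4θ < 1/2`, `0 < q` there is `β₀ ≥ 1` such
that for `β ≥ β₀`, `1 ≤ H ≤ β^θ + 1`: `s ≤ 1`, `s < π`, `252·s < 1/4/H²`, `det M_FP(edgeChart a) ≠ 0` on `smallField H s`, and `β^{−q} ≤ 1/2`. -/
theorem exists_beta0_sideConditions {θ κ₃ q : ℝ} (hθ : 0 < θ) (hκ0 : 0 < κ₃) (hK4 : κ₃ + 4 * θ < 1 / 2) (hq : 0 < q) :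
    ∃ β₀ : ℝ, 1 ≤ β₀ ∧ ∀ β : ℝ, β₀ ≤ β → ∀ H : ℕ, 1 ≤ H → (H : ℝ) ≤ β ^ θ + 1 →
      β ^ (-1 / 2 + κ₃) ≤ 1 ∧ β ^ (-1 / 2 + κ₃) < Real.pi ∧ 252 * β ^ (-1 / 2 + κ₃) < 1 / 4 / (H : ℝ) ^ 2 ∧
      (∀ a ∈ smallField H (β ^ (-1 / 2 + κ₃)), (fpOperator H (edgeChart H a)).det ≠ 0) ∧ β ^ (-q) ≤ 1 / 2 := by
  have hθ0 : 0 ≤ θ := hθ.le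
  obtain ⟨b₀, hb₀1, hb₀⟩ := ErrorBudget.exists_forall_natPow_log_le (k := 2) (γ := 1 / 2 - κ₃) hθ0 (by push_cast; linarith)
    (by norm_num : (0 : ℝ) < 1 / 2016) 1 0 0
  obtain ⟨b₁, hb₁1, hb₁⟩ := ErrorBudget.exists_forall_natPow_log_le (k := 0) (γ := q) hθ0 (by push_cast; linarith)
    (by norm_num : (0 : ℝ) < 1 / 2) 1 0 0
  refine ⟨max b₀ b₁, le_max_of_le_left hb₀1, fun β hβ H hH hHβ => ?_⟩
  have hβ0 : b₀ ≤ β := (le_max_left _ _).trans hβ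
  have hβ1 : b₁ ≤ β := (le_max_right _ _).trans hβ
  have hβone : 1 ≤ β := hb₀1.trans hβ0
  have hβpos : 0 < β := by linarith
  have hH1 : (1 : ℝ) ≤ H := by exact_mod_cast hH
  have hH2 : (0 : ℝ) < (H : ℝ) ^ 2 := by positivity
  set s : ℝ := β ^ (-1 / 2 + κ₃) with hs
  have hs0 : 0 ≤ s := (Real.rpow_pos_of_pos hβpos _).le
  have hs1 : s ≤ 1 := Real.rpow_le_one_of_one_le_of_nonpos hβone (by linarith)
  have hsH : s * (H : ℝ) ^ 2 ≤ 1 / 2016 := by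
    have e : s * (H : ℝ) ^ 2 = 1 * (H : ℝ) ^ 2 * (1 + Real.log H) ^ 0 * (1 + Real.log β) ^ 0 / β ^ (1 / 2 - κ₃) := by
      rw [hs, rpow_eq_one_div hβpos, pow_zero, pow_zero]; ring
    rw [e]; exact hb₀ β hβ0 H hH hHβ
  have h252 : 252 * s < 1 / 4 / (H : ℝ) ^ 2 := by
    rw [lt_div_iff₀ hH2]
    nlinarith
  have hq2 : β ^ (-q) ≤ 1 / 2 := by
    have h := hb₁ β hβ1 H hH hHβ
    rw [pow_zero, pow_zero, pow_zero, mul_one, mul_one, mul_one] at h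
    rwa [Real.rpow_neg hβpos.le, ← one_div]
  exact ⟨hs1, lt_of_le_of_lt hs1 (by linarith [Real.pi_gt_three]), h252,
    GaussNormalForm.det_fpOperator_edgeChart_ne_zero (H := H) hH hs0 hs1 h252, hq2⟩

/-- ★★ **CUT-SET RECORD WITH THE `t = 1` CURRENCY SWITCH** (ASSEMBLY-U5 §3 Step C′).  For `0 < θ`, `0 < κ₃`, (K4) `κ₃ + 4θ < 1/2`,
`4θ + 4κ₃ < 1`, `6θ + 2κ₃ < 1` and `0 < q`: ONE `C₅ ≥ 0` and ONE `β₀ ≥ 1` such that for every `β ≥ β₀`, `1 ≤ H ≤ β^θ + 1`, with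
`s = β^{−1/2+κ₃}`, `E = {1 + C₅βH⁴s⁵ ≤ |cubicVertex β H ·|}`, `D′ = smallField H s ∖ E`: the conclusions (i)–(iv) of ✓`exists_cutSet_record`,
(v) the side conditions of ✓`exists_beta0_sideConditions`, and (vi) for every `r ≥ s` and all `x y : Site 4`
`|Cov^{w_J}_{smallField s}(c_x, c_y) − Tilt.tiltCov μ_{D′} (tiltU β H) 1 c_x c_y| ≤ 96·β^{−q}` (`w_J = fpChartWeight β H r`, `c_x = chartPlaqCost H x 1 2`). -/
theorem exists_cutSet_record_switch {θ κ₃ q : ℝ} (hθ : 0 < θ) (hκ0 : 0 < κ₃) (hK4 : κ₃ + 4 * θ < 1 / 2) (h4 : 4 * θ + 4 * κ₃ < 1)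
    (h6 : 6 * θ + 2 * κ₃ < 1) (hq : 0 < q) :
    ∃ C₅ β₀ : ℝ, 0 ≤ C₅ ∧ 1 ≤ β₀ ∧ ∀ β : ℝ, β₀ ≤ β → ∀ H : ℕ, 1 ≤ H → (H : ℝ) ≤ β ^ θ + 1 →
      (∀ a ∈ smallField H (β ^ (-1 / 2 + κ₃)) \
          {a | 1 + C₅ * β * (H : ℝ) ^ 4 * (β ^ (-1 / 2 + κ₃)) ^ 5 ≤ |cubicVertex β H a|}, |tiltU β H a| ≤ 2) ∧
      (∀ r : ℝ, β ^ (-1 / 2 + κ₃) ≤ r →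
        ∫ a in smallField H (β ^ (-1 / 2 + κ₃)) ∩
            {a | 1 + C₅ * β * (H : ℝ) ^ 4 * (β ^ (-1 / 2 + κ₃)) ^ 5 ≤ |cubicVertex β H a|}, fpChartWeight β H r a ≤
          β ^ (-q) * ∫ a in smallField H (β ^ (-1 / 2 + κ₃)) \
            {a | 1 + C₅ * β * (H : ℝ) ^ 4 * (β ^ (-1 / 2 + κ₃)) ^ 5 ≤ |cubicVertex β H a|}, fpChartWeight β H r a) ∧
      (∀ r : ℝ, β ^ (-1 / 2 + κ₃) ≤ r →
        ∫ a in smallField H (β ^ (-1 / 2 + κ₃)) ∩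
            {a | 1 + C₅ * β * (H : ℝ) ^ 4 * (β ^ (-1 / 2 + κ₃)) ^ 5 ≤ |cubicVertex β H a|}, fpChartWeight β H r a ≤
          β ^ (-q) * ∫ a in smallField H (β ^ (-1 / 2 + κ₃) / 2) \
            {a | 1 + C₅ * β * (H : ℝ) ^ 4 * (β ^ (-1 / 2 + κ₃)) ^ 5 ≤ |cubicVertex β H a|}, fpChartWeight β H r a) ∧
      (gaussAvg β H (fun a => 1 - (smallField H (β ^ (-1 / 2 + κ₃)) \
          {a | 1 + C₅ * β * (H : ℝ) ^ 4 * (β ^ (-1 / 2 + κ₃)) ^ 5 ≤ |cubicVertex β H a|}).indicator (fun _ => (1 : ℝ)) a) ≤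
        β ^ (-q) / 2 ∧
      gaussAvg β H (fun a => 1 - (smallField H (β ^ (-1 / 2 + κ₃)) \
          {a | 1 + C₅ * β * (H : ℝ) ^ 4 * (β ^ (-1 / 2 + κ₃)) ^ 5 ≤ |cubicVertex β H a|}).indicator (fun _ => (1 : ℝ)) a) ≤ 1 / 2 ∧
      1 / 2 ≤ gaussAvg β H ((smallField H (β ^ (-1 / 2 + κ₃)) \
          {a | 1 + C₅ * β * (H : ℝ) ^ 4 * (β ^ (-1 / 2 + κ₃)) ^ 5 ≤ |cubicVertex β H a|}).indicator fun _ => (1 : ℝ))) ∧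
      (β ^ (-1 / 2 + κ₃) ≤ 1 ∧ β ^ (-1 / 2 + κ₃) < Real.pi ∧ 252 * β ^ (-1 / 2 + κ₃) < 1 / 4 / (H : ℝ) ^ 2 ∧
        (∀ a ∈ smallField H (β ^ (-1 / 2 + κ₃)), (fpOperator H (edgeChart H a)).det ≠ 0) ∧ β ^ (-q) ≤ 1 / 2) ∧
      (∀ r : ℝ, β ^ (-1 / 2 + κ₃) ≤ r → ∀ x y : Site 4,
        |((∫ a in smallField H (β ^ (-1 / 2 + κ₃)), chartPlaqCost H x 1 2 a * chartPlaqCost H y 1 2 a * fpChartWeight β H r a) /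
                (∫ a in smallField H (β ^ (-1 / 2 + κ₃)), fpChartWeight β H r a) -
              (∫ a in smallField H (β ^ (-1 / 2 + κ₃)), chartPlaqCost H x 1 2 a * fpChartWeight β H r a) /
                  (∫ a in smallField H (β ^ (-1 / 2 + κ₃)), fpChartWeight β H r a) *
                ((∫ a in smallField H (β ^ (-1 / 2 + κ₃)), chartPlaqCost H y 1 2 a * fpChartWeight β H r a) /
                  (∫ a in smallField H (β ^ (-1 / 2 + κ₃)), fpChartWeight β H r a))) -
            Tilt.tiltCov (((volume : Measure (LandauFree H → E3)).restrict (smallField H (β ^ (-1 / 2 + κ₃)) \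
                {a | 1 + C₅ * β * (H : ℝ) ^ 4 * (β ^ (-1 / 2 + κ₃)) ^ 5 ≤ |cubicVertex β H a|})).withDensity fun a =>
                ENNReal.ofReal (gaussWeight β H a)) (tiltU β H) 1 (chartPlaqCost H x 1 2) (chartPlaqCost H y 1 2)| ≤
          96 * β ^ (-q)) := by
  obtain ⟨C₅, b₀, hC₅, hb₀1, hrec⟩ := exists_cutSet_record (q := q) hθ hκ0 hK4 h4 h6 hq.le
  obtain ⟨b₁, hb₁1, hside⟩ := exists_beta0_sideConditions (q := q) hθ hκ0 hK4 hq
  refine ⟨C₅, max b₀ b₁, hC₅, le_max_of_le_left hb₀1, fun β hβ H hH hHβ => ?_⟩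
  have hβ0 : b₀ ≤ β := (le_max_left _ _).trans hβ
  have hβ1 : b₁ ≤ β := (le_max_right _ _).trans hβ
  have hβpos : 0 < β := by linarith
  obtain ⟨hsup, hcut, hcut2, hco, hco2, hmass⟩ := hrec β hβ0 H hH hHβ
  obtain ⟨hs1, hsπ, h252, hdet, hq2⟩ := hside β hβ1 H hH hHβ
  refine ⟨hsup, hcut, hcut2, ⟨hco, hco2, hmass⟩, ⟨hs1, hsπ, h252, hdet, hq2⟩, fun r hr x y => ?_⟩
  have hs : 0 < β ^ (-1 / 2 + κ₃) := Real.rpow_pos_of_pos hβpos _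
  exact GaussNormalForm.abs_chartCov_sub_tiltCov_muCut_one_le_chartPlaqCost hH hβpos.le hs hr hsπ (lt_of_lt_of_le hs hr) hdet
    (measurableSet_cubicCut β C₅ _ 1) (Real.rpow_nonneg hβpos.le _) (hcut r hr) hq2 x y

/-- ★ **The ε-form** (✓`AssemblyBudget.cut_budget` at `q := 8θ + 3`): for `0 < θ`, `0 < κ₃`, (K4), `4θ + 4κ₃ < 1`, `6θ + 2κ₃ < 1` and every
`ε > 0`: ONE `C₅ ≥ 0`, ONE `β₀ ≥ 1` with, for `β ≥ β₀`, `1 ≤ H ≤ β^θ + 1` (`s = β^{−1/2+κ₃}`, `D′` as above): `sup_{D′}|tiltU| ≤ 2`,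
the same-radius cut at `τ = β^{−(8θ+3)}`, `E₀[1 − 1_{D′}] ≤ 1/2`, `1/2 ≤ E₀[1_{D′}]`, the side conditions, and the RELATIVE currency switch
`β²·H⁸·|Cov^{w_J}_{smallField s}(c_x, c_y) − Tilt.tiltCov μ_{D′} (tiltU β H) 1 c_x c_y| ≤ ε` for every `r ≥ s`, `x y : Site 4`. -/
theorem exists_cutSet_record_eps {θ κ₃ : ℝ} (hθ : 0 < θ) (hκ0 : 0 < κ₃) (hK4 : κ₃ + 4 * θ < 1 / 2) (h4 : 4 * θ + 4 * κ₃ < 1)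
    (h6 : 6 * θ + 2 * κ₃ < 1) {ε : ℝ} (hε : 0 < ε) :
    ∃ C₅ β₀ : ℝ, 0 ≤ C₅ ∧ 1 ≤ β₀ ∧ ∀ β : ℝ, β₀ ≤ β → ∀ H : ℕ, 1 ≤ H → (H : ℝ) ≤ β ^ θ + 1 →
      (∀ a ∈ smallField H (β ^ (-1 / 2 + κ₃)) \
          {a | 1 + C₅ * β * (H : ℝ) ^ 4 * (β ^ (-1 / 2 + κ₃)) ^ 5 ≤ |cubicVertex β H a|}, |tiltU β H a| ≤ 2) ∧
      (∀ r : ℝ, β ^ (-1 / 2 + κ₃) ≤ r →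
        ∫ a in smallField H (β ^ (-1 / 2 + κ₃)) ∩
            {a | 1 + C₅ * β * (H : ℝ) ^ 4 * (β ^ (-1 / 2 + κ₃)) ^ 5 ≤ |cubicVertex β H a|}, fpChartWeight β H r a ≤
          β ^ (-(8 * θ + 3)) * ∫ a in smallField H (β ^ (-1 / 2 + κ₃)) \
            {a | 1 + C₅ * β * (H : ℝ) ^ 4 * (β ^ (-1 / 2 + κ₃)) ^ 5 ≤ |cubicVertex β H a|}, fpChartWeight β H r a) ∧
      gaussAvg β H (fun a => 1 - (smallField H (β ^ (-1 / 2 + κ₃)) \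
          {a | 1 + C₅ * β * (H : ℝ) ^ 4 * (β ^ (-1 / 2 + κ₃)) ^ 5 ≤ |cubicVertex β H a|}).indicator (fun _ => (1 : ℝ)) a) ≤ 1 / 2 ∧
      1 / 2 ≤ gaussAvg β H ((smallField H (β ^ (-1 / 2 + κ₃)) \
          {a | 1 + C₅ * β * (H : ℝ) ^ 4 * (β ^ (-1 / 2 + κ₃)) ^ 5 ≤ |cubicVertex β H a|}).indicator fun _ => (1 : ℝ)) ∧
      (β ^ (-1 / 2 + κ₃) ≤ 1 ∧ β ^ (-1 / 2 + κ₃) < Real.pi ∧ 252 * β ^ (-1 / 2 + κ₃) < 1 / 4 / (H : ℝ) ^ 2 ∧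
        (∀ a ∈ smallField H (β ^ (-1 / 2 + κ₃)), (fpOperator H (edgeChart H a)).det ≠ 0)) ∧
      (∀ r : ℝ, β ^ (-1 / 2 + κ₃) ≤ r → ∀ x y : Site 4,
        β ^ 2 * (H : ℝ) ^ 8 *
          |((∫ a in smallField H (β ^ (-1 / 2 + κ₃)), chartPlaqCost H x 1 2 a * chartPlaqCost H y 1 2 a * fpChartWeight β H r a) /
                (∫ a in smallField H (β ^ (-1 / 2 + κ₃)), fpChartWeight β H r a) -
              (∫ a in smallField H (β ^ (-1 / 2 + κ₃)), chartPlaqCost H x 1 2 a * fpChartWeight β H r a) /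
                  (∫ a in smallField H (β ^ (-1 / 2 + κ₃)), fpChartWeight β H r a) *
                ((∫ a in smallField H (β ^ (-1 / 2 + κ₃)), chartPlaqCost H y 1 2 a * fpChartWeight β H r a) /
                  (∫ a in smallField H (β ^ (-1 / 2 + κ₃)), fpChartWeight β H r a))) -
            Tilt.tiltCov (((volume : Measure (LandauFree H → E3)).restrict (smallField H (β ^ (-1 / 2 + κ₃)) \
                {a | 1 + C₅ * β * (H : ℝ) ^ 4 * (β ^ (-1 / 2 + κ₃)) ^ 5 ≤ |cubicVertex β H a|})).withDensity fun a =>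
                ENNReal.ofReal (gaussWeight β H a)) (tiltU β H) 1 (chartPlaqCost H x 1 2) (chartPlaqCost H y 1 2)| ≤ ε) := by
  have hθ0 : 0 ≤ θ := hθ.le
  have hq : 0 < 8 * θ + 3 := by linarith
  obtain ⟨C₅, b₀, hC₅, hb₀1, hrec⟩ := exists_cutSet_record_switch (q := 8 * θ + 3) hθ hκ0 hK4 h4 h6 hq
  obtain ⟨b₁, hb₁1, hbud⟩ := AssemblyBudget.cut_budget (q := 8 * θ + 3) hθ0 (by linarith) hε
  refine ⟨C₅, max b₀ b₁, hC₅, le_max_of_le_left hb₀1, fun β hβ H hH hHβ => ?_⟩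
  have hβ0 : b₀ ≤ β := (le_max_left _ _).trans hβ
  have hβ1 : b₁ ≤ β := (le_max_right _ _).trans hβ
  obtain ⟨hsup, hcut, -, ⟨-, hco2, hmass⟩, ⟨hs1, hsπ, h252, hdet, -⟩, hsw⟩ := hrec β hβ0 H hH hHβ
  refine ⟨hsup, hcut, hco2, hmass, ⟨hs1, hsπ, h252, hdet⟩, fun r hr x y => ?_⟩
  have h1 := hsw r hr x y
  have h2 := hbud β hβ1 H hH hHβ
  have hβH : 0 ≤ β ^ 2 * (H : ℝ) ^ 8 := by positivity
  exact (mul_le_mul_of_nonneg_left h1 hβH).trans h2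

end CutSetRecord

end Summit.QuantumFields.YangMills.Theorems.AllWindowsColdBoxBoxHighLine
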